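import Mathlib
import Summits.ValiantsHypothesis.ValiantsHypothesis.Theorems.LacunarySymmetroidMatrixDescartesCensusRealExponentsCubicSigns

/-!
# `MatrixDescartes` census — the first-order structure of `det(F + xV)` at a singular symmetric `F` (every size)

HONEST FRAMING.  Object-search cell `pub-symmetroid`, items `DoorA26 = PosRootLawAt 2 6 19`
(stmt-ValiantsHypothesis-19979) / `DoorA34 = PosRootLawAt 3 4 18` (stmt-ValiantsHypothesis-19980), OPEN,
typed, never asserted; this file is the size-free linear algebra behind the non-sharp real-exponent
transfer for EVERY `m` (`…CensusRealExponentsAllSizes`), deciding nothing.  Nothing here bears on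
`MatrixDescartes` (stmt-ValiantsHypothesis-18050) or `VP ≠ VNP`.

* `det_diagonal_add_smul_eq` — SCHUR FACTORISATION around the zero block: for a real diagonal `D` with
  zero set `Z` and any `V` whose principal `Z`-block `V_Z` is non-singular,
  `det(diag D + x·V) = x^{#Z} · det V_Z · det(D' + x·C)` (all `x`), with `D'` the non-zero diagonal
  block and a constant matrix `C`; hence (`eventually_pos_det_diagonal_add_smul`) for all small `x ≠ 0`
  the sign of `det(diag D + x·V)` is `sign(x)^{#Z} · sign(det V_Z) · sign(∏_{i ∉ Z} D_i)`;
* `det_add_smul_eq_det_diagonal` — for a real symmetric `F = U·diag(λ)·Uᵀ` (spectral theorem),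
  `det(F + x·V) = det(diag λ + x·UᵀVU)`;
* `submatrix_one_val`, `det_one_sub_smul_vecMulVec_val` — the `Z`-blocks of `Uᵀ·1·U = 1` and of
  `Uᵀ(1 − κ·nnᵀ)U = 1 − κ·wwᵀ` (`w = Uᵀn`): determinants `1` and `1 − κ·Σ_{i ∈ Z} w_i²`.

[folklore] Schur complement; spectral theorem for real symmetric matrices (Mathlib).
-/

-- `Summit.ValiantsHypothesis.ValiantsHypothesis.…` repeats a component by the D-0017 layout
-- (single-conjunct summit), which the `dupNamespace` linter flags; the name is mandated.
set_option linter.dupNamespace false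

namespace Summit.ValiantsHypothesis.ValiantsHypothesis.Theorems.LacunarySymmetroidMatrixDescartes.Census.RealExp

open Finset Filter Topology Matrix
open scoped BigOperators Matrix

section SchurBlock

variable {ι : Type*} [Fintype ι] [DecidableEq ι]

/-- **Schur factorisation around the zero block.**  `D` real diagonal entries, `Z = {i : D i = 0}`,
`V` any matrix with non-singular principal `Z`-block `V_Z`: for every `x`,
`det(diag D + x·V) = x^{#Z} · det V_Z · det(D' + x·C)` where `D'` is the diagonal block off `Z` and
`C = V_{Z'Z'} − V_{Z'Z} V_Z⁻¹ V_{ZZ'}`. [folklore] -/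
theorem det_diagonal_add_smul_eq (D : ι → ℝ) (V : Matrix ι ι ℝ)
    (hV : (V.submatrix (fun i : {i // D i = 0} => (i : ι)) (fun i : {i // D i = 0} => (i : ι))).det ≠ 0)
    (x : ℝ) :
    (Matrix.diagonal D + x • V).det =
      x ^ Fintype.card {i // D i = 0} *
        (V.submatrix (fun i : {i // D i = 0} => (i : ι)) (fun i : {i // D i = 0} => (i : ι))).det *
        (Matrix.diagonal (fun i : {i // ¬ D i = 0} => D i) +
          x • (V.submatrix (fun i : {i // ¬ D i = 0} => (i : ι)) (fun i : {i // ¬ D i = 0} => (i : ι)) -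
            V.submatrix (fun i : {i // ¬ D i = 0} => (i : ι)) (fun i : {i // D i = 0} => (i : ι)) *
            (V.submatrix (fun i : {i // D i = 0} => (i : ι)) (fun i : {i // D i = 0} => (i : ι)))⁻¹ *
            V.submatrix (fun i : {i // D i = 0} => (i : ι)) (fun i : {i // ¬ D i = 0} => (i : ι)))).det := by
  set p : ι → Prop := fun i => D i = 0 with hp
  set e := Equiv.sumCompl p with he
  set V₁₁ : Matrix {i // p i} {i // p i} ℝ := V.submatrix (fun i => (i : ι)) (fun i => (i : ι)) with hV₁₁
  set V₁₂ : Matrix {i // p i} {i // ¬ p i} ℝ := V.submatrix (fun i => (i : ι)) (fun i => (i : ι)) with hV₁₂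
  set V₂₁ : Matrix {i // ¬ p i} {i // p i} ℝ := V.submatrix (fun i => (i : ι)) (fun i => (i : ι)) with hV₂₁
  set V₂₂ : Matrix {i // ¬ p i} {i // ¬ p i} ℝ := V.submatrix (fun i => (i : ι)) (fun i => (i : ι)) with hV₂₂
  set D₂ : Matrix {i // ¬ p i} {i // ¬ p i} ℝ := Matrix.diagonal (fun i => D i) with hD₂
  change (Matrix.diagonal D + x • V).det =
    x ^ Fintype.card {i // p i} * V₁₁.det * (D₂ + x • (V₂₂ - V₂₁ * V₁₁⁻¹ * V₁₂)).det
  have hunit : IsUnit V₁₁.det := isUnit_iff_ne_zero.mpr hV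
  -- reindex along `e` and read off the blocks
  have hblocks : (Matrix.diagonal D + x • V).submatrix e e =
      Matrix.fromBlocks (x • V₁₁) (x • V₁₂) (x • V₂₁) (D₂ + x • V₂₂) := by
    ext (i | i) (j | j)
    · simp only [Matrix.submatrix_apply, he, Equiv.sumCompl_apply_inl, Matrix.fromBlocks_apply₁₁,
        Matrix.add_apply, Matrix.smul_apply, smul_eq_mul, hV₁₁, Matrix.diagonal_apply]
      have : D (i : ι) = 0 := i.2
      split_ifs <;> simp [this]
    · simp only [Matrix.submatrix_apply, he, Equiv.sumCompl_apply_inl, Equiv.sumCompl_apply_inr,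
        Matrix.fromBlocks_apply₁₂, Matrix.add_apply, Matrix.smul_apply, smul_eq_mul, hV₁₂,
        Matrix.diagonal_apply]
      have hne : (i : ι) ≠ (j : ι) := fun h => j.2 (h ▸ i.2)
      simp [hne]
    · simp only [Matrix.submatrix_apply, he, Equiv.sumCompl_apply_inl, Equiv.sumCompl_apply_inr,
        Matrix.fromBlocks_apply₂₁, Matrix.add_apply, Matrix.smul_apply, smul_eq_mul, hV₂₁,
        Matrix.diagonal_apply]
      have hne : (i : ι) ≠ (j : ι) := fun h => i.2 (h ▸ j.2)
      simp [hne]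
    · simp only [Matrix.submatrix_apply, he, Equiv.sumCompl_apply_inr, Matrix.fromBlocks_apply₂₂,
        Matrix.add_apply, Matrix.smul_apply, smul_eq_mul, hV₂₂, hD₂, Matrix.diagonal_apply]
      by_cases hij : i = j
      · subst hij; simp
      · have hne : (i : ι) ≠ (j : ι) := fun h => hij (Subtype.ext h)
        simp [hij, hne]
  -- block LU factorisation
  have hmul : Matrix.fromBlocks (x • V₁₁) (x • V₁₂) (x • V₂₁) (D₂ + x • V₂₂) =
      Matrix.fromBlocks (x • V₁₁) 0 (x • V₂₁) 1 *
        Matrix.fromBlocks 1 (V₁₁⁻¹ * V₁₂) 0 (D₂ + x • (V₂₂ - V₂₁ * V₁₁⁻¹ * V₁₂)) := by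
    rw [Matrix.fromBlocks_multiply]
    congr 1
    · simp
    · rw [Matrix.zero_mul, add_zero, Matrix.smul_mul, ← Matrix.mul_assoc,
        Matrix.mul_nonsing_inv _ hunit, Matrix.one_mul]
    · simp
    · rw [Matrix.one_mul, Matrix.smul_mul, smul_sub, Matrix.mul_assoc]
      abel
  rw [← Matrix.det_submatrix_equiv_self e, hblocks, hmul, Matrix.det_mul, Matrix.det_fromBlocks_zero₁₂,
    Matrix.det_fromBlocks_zero₂₁, Matrix.det_one, Matrix.det_one, mul_one, one_mul, Matrix.det_smul,
    Fintype.card_subtype]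

/-- **Sign of `det(diag D + x·V)` for small `x ≠ 0`.**  With `Z = {i : D i = 0}` and `det V_Z ≠ 0`: for
all `x` near `0`, `x ≠ 0 →  0 < x^{#Z} · det V_Z · (∏_{i ∉ Z} D_i) · det(diag D + x·V)`. [folklore] -/
theorem eventually_pos_det_diagonal_add_smul (D : ι → ℝ) (V : Matrix ι ι ℝ)
    (hV : (V.submatrix (fun i : {i // D i = 0} => (i : ι)) (fun i : {i // D i = 0} => (i : ι))).det ≠ 0) :
    ∀ᶠ x in 𝓝 (0 : ℝ), x ≠ 0 →
      0 < x ^ Fintype.card {i // D i = 0} *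
        (V.submatrix (fun i : {i // D i = 0} => (i : ι)) (fun i : {i // D i = 0} => (i : ι))).det *
        (∏ i : {i // ¬ D i = 0}, D i) * (Matrix.diagonal D + x • V).det := by
  set V₁₁ : Matrix {i // D i = 0} {i // D i = 0} ℝ :=
    V.submatrix (fun i => (i : ι)) (fun i => (i : ι)) with hV₁₁
  set C : Matrix {i // ¬ D i = 0} {i // ¬ D i = 0} ℝ :=
    V.submatrix (fun i : {i // ¬ D i = 0} => (i : ι)) (fun i : {i // ¬ D i = 0} => (i : ι)) -
      V.submatrix (fun i : {i // ¬ D i = 0} => (i : ι)) (fun i : {i // D i = 0} => (i : ι)) * V₁₁⁻¹ *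
      V.submatrix (fun i : {i // D i = 0} => (i : ι)) (fun i : {i // ¬ D i = 0} => (i : ι)) with hC
  set D₂ : Matrix {i // ¬ D i = 0} {i // ¬ D i = 0} ℝ := Matrix.diagonal (fun i => D i) with hD₂
  set g : ℝ → ℝ := fun x => (D₂ + x • C).det with hg
  have hg0 : g 0 = ∏ i : {i // ¬ D i = 0}, D i := by simp [hg, hD₂, Matrix.det_diagonal]
  have hprod : (∏ i : {i // ¬ D i = 0}, D i) ≠ 0 := Finset.prod_ne_zero_iff.mpr fun i _ => i.2
  have hgcont : Continuous g := by
    simp only [hg]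
    exact (continuous_const.add (continuous_id.smul continuous_const)).matrix_det
  have hev : ∀ᶠ x in 𝓝 (0 : ℝ), 0 < g x * g 0 := by
    have h0 : 0 < g 0 * g 0 := mul_self_pos.mpr (by rw [hg0]; exact hprod)
    exact ((hgcont.mul continuous_const).continuousAt).eventually (lt_mem_nhds h0)
  refine hev.mono fun x hx hx0 => ?_
  rw [det_diagonal_add_smul_eq D V hV x]
  change 0 < x ^ _ * V₁₁.det * (∏ i : {i // ¬ D i = 0}, D i) * (x ^ _ * V₁₁.det * g x)
  rw [← hg0]
  have hne : x ^ Fintype.card {i // D i = 0} * V₁₁.det ≠ 0 := mul_ne_zero (pow_ne_zero _ hx0) hV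
  have h1 : 0 < (x ^ Fintype.card {i // D i = 0} * V₁₁.det) ^ 2 := by positivity
  have : x ^ Fintype.card {i // D i = 0} * V₁₁.det * g 0 * (x ^ Fintype.card {i // D i = 0} * V₁₁.det * g x) =
      (x ^ Fintype.card {i // D i = 0} * V₁₁.det) ^ 2 * (g x * g 0) := by ring
  rw [this]
  exact mul_pos h1 hx

end SchurBlock

section Spectral

variable {n : Type*} [Fintype n] [DecidableEq n]

/-- **Conjugating into the eigenbasis.**  For a real symmetric (`IsHermitian`) matrix `F` with
`F = U·diag(λ)·Uᵀ` (`Matrix.IsHermitian.spectral_theorem`): `det(F + x·V) = det(diag λ + x·UᵀVU)`.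
[folklore] -/
theorem det_add_smul_eq_det_diagonal {F : Matrix n n ℝ} (hF : F.IsHermitian) (V : Matrix n n ℝ)
    (x : ℝ) :
    (F + x • V).det = (Matrix.diagonal hF.eigenvalues +
      x • (star (hF.eigenvectorUnitary : Matrix n n ℝ) * V * (hF.eigenvectorUnitary : Matrix n n ℝ))).det := by
  set U : Matrix n n ℝ := (hF.eigenvectorUnitary : Matrix n n ℝ) with hU
  have hUU : U * star U = 1 := Unitary.coe_mul_star_self hF.eigenvectorUnitary
  have hUU' : star U * U = 1 := Unitary.coe_star_mul_self hF.eigenvectorUnitary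
  have hspec : F = U * Matrix.diagonal hF.eigenvalues * star U := by
    have h := hF.spectral_theorem
    rw [Unitary.conjStarAlgAut_apply] at h
    simpa [RCLike.ofReal_real_eq_id] using h
  have key : F + x • V = U * (Matrix.diagonal hF.eigenvalues + x • (star U * V * U)) * star U := by
    rw [Matrix.mul_add, Matrix.add_mul, ← hspec, Matrix.mul_smul, Matrix.smul_mul, ← Matrix.mul_assoc,
      ← Matrix.mul_assoc, hUU, Matrix.one_mul, Matrix.mul_assoc, hUU, Matrix.mul_one]
  have hdet : U.det * (star U).det = 1 := by rw [← Matrix.det_mul, hUU, Matrix.det_one]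
  rw [key, Matrix.det_mul, Matrix.det_mul]
  calc U.det * (Matrix.diagonal hF.eigenvalues + x • (star U * V * U)).det * (star U).det
      = (U.det * (star U).det) * (Matrix.diagonal hF.eigenvalues + x • (star U * V * U)).det := by ring
    _ = _ := by rw [hdet, one_mul]

/-- A singular real symmetric matrix has a zero eigenvalue. [folklore] -/
theorem exists_eigenvalues_eq_zero {F : Matrix n n ℝ} (hF : F.IsHermitian) (hdet : F.det = 0) :
    ∃ i, hF.eigenvalues i = 0 := by
  rw [hF.det_eq_prod_eigenvalues] at hdet
  simpa using Finset.prod_eq_zero_iff.mp hdet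

/-- The columns of the eigenvector matrix are unit vectors, hence non-zero. [folklore] -/
theorem eigenvectorUnitary_col_ne_zero {F : Matrix n n ℝ} (hF : F.IsHermitian) (i : n) :
    (fun a => (hF.eigenvectorUnitary : Matrix n n ℝ) a i) ≠ 0 := by
  set U : Matrix n n ℝ := (hF.eigenvectorUnitary : Matrix n n ℝ) with hU
  intro h0
  have hUU' : star U * U = 1 := Unitary.coe_star_mul_self hF.eigenvectorUnitary
  have h1 := congrFun (congrFun hUU' i) i
  rw [Matrix.mul_apply, Matrix.one_apply_eq] at h1
  have h2 : ∀ a, U a i = 0 := fun a => congrFun h0 a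
  simp only [Matrix.star_apply, h2, mul_zero, Finset.sum_const_zero] at h1
  exact zero_ne_one h1

/-- Conjugating the identity letter: `Uᵀ·1·U = 1`. [folklore] -/
theorem star_mul_one_mul_eigenvectorUnitary {F : Matrix n n ℝ} (hF : F.IsHermitian) :
    star (hF.eigenvectorUnitary : Matrix n n ℝ) * 1 * (hF.eigenvectorUnitary : Matrix n n ℝ) = 1 := by
  rw [Matrix.mul_one]; exact Unitary.coe_star_mul_self hF.eigenvectorUnitary

/-- Conjugating the rank-one letter: `Uᵀ(1 − κ·vvᵀ)U = 1 − κ·wwᵀ` with `w = v ᵥ* U`. [folklore] -/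
theorem star_mul_one_sub_smul_vecMulVec_mul_eigenvectorUnitary {F : Matrix n n ℝ} (hF : F.IsHermitian)
    (κ : ℝ) (v : n → ℝ) :
    star (hF.eigenvectorUnitary : Matrix n n ℝ) * (1 - κ • Matrix.vecMulVec v v) *
        (hF.eigenvectorUnitary : Matrix n n ℝ) =
      1 - κ • Matrix.vecMulVec (v ᵥ* (hF.eigenvectorUnitary : Matrix n n ℝ))
        (v ᵥ* (hF.eigenvectorUnitary : Matrix n n ℝ)) := by
  set U : Matrix n n ℝ := (hF.eigenvectorUnitary : Matrix n n ℝ) with hU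
  have hUU' : star U * U = 1 := Unitary.coe_star_mul_self hF.eigenvectorUnitary
  have hstar : star U = Uᵀ := by
    rw [Matrix.star_eq_conjTranspose, Matrix.conjTranspose_eq_transpose_of_trivial]
  rw [Matrix.mul_sub, Matrix.sub_mul, Matrix.mul_one, hUU', Matrix.mul_smul, Matrix.smul_mul,
    Matrix.mul_vecMulVec, Matrix.vecMulVec_mul, hstar, Matrix.mulVec_transpose]

omit [Fintype n] in
/-- Principal blocks of `1` are `1`. [folklore] -/
theorem submatrix_one_val (p : n → Prop) :
    (1 : Matrix n n ℝ).submatrix (fun i : {i // p i} => (i : n)) (fun i : {i // p i} => (i : n)) = 1 :=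
  Matrix.submatrix_one _ Subtype.val_injective

omit [Fintype n] [DecidableEq n] in
/-- Principal blocks of a rank-one matrix. [folklore] -/
theorem submatrix_vecMulVec_val (p : n → Prop) (w : n → ℝ) :
    (Matrix.vecMulVec w w).submatrix (fun i : {i // p i} => (i : n)) (fun i : {i // p i} => (i : n)) =
      Matrix.vecMulVec (fun i : {i // p i} => w i) (fun i : {i // p i} => w i) := by
  ext i j; simp [Matrix.vecMulVec_apply]

omit [Fintype n] in
/-- Principal blocks of `1 − κ·wwᵀ`. [folklore] -/
theorem submatrix_one_sub_smul_vecMulVec_val (p : n → Prop) (κ : ℝ) (w : n → ℝ) :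
    (1 - κ • Matrix.vecMulVec w w : Matrix n n ℝ).submatrix (fun i : {i // p i} => (i : n))
        (fun i : {i // p i} => (i : n)) =
      1 - κ • Matrix.vecMulVec (fun i : {i // p i} => w i) (fun i : {i // p i} => w i) := by
  ext i j
  simp [Matrix.submatrix_apply, Matrix.one_apply, Matrix.vecMulVec_apply, Subtype.val_inj]

/-- **Matrix determinant lemma, rank one:** `det(1 − κ·wwᵀ) = 1 − κ|w|²`. [folklore] -/
theorem det_one_sub_smul_vecMulVec' {ι : Type*} [Fintype ι] [DecidableEq ι] (κ : ℝ) (w : ι → ℝ) :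
    (1 - κ • Matrix.vecMulVec w w : Matrix ι ι ℝ).det = 1 - κ * (w ⬝ᵥ w) := by
  rw [← Matrix.smul_vecMulVec, Matrix.vecMulVec_eq (ι := Unit), Matrix.det_one_sub_mul_comm,
    Matrix.det_unique, Matrix.sub_apply, Matrix.one_apply_eq, Matrix.replicateRow_mul_replicateCol_apply,
    dotProduct_smul, smul_eq_mul]

end Spectral

section MomentCurve

/-- The moment-curve polynomial `Σ_j v_j X^j` of a non-zero coefficient vector is non-zero, so the
parameters `t` with `v ⬝ (t^j)_j = 0` form a finite set. [folklore] -/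
theorem finite_setOf_dotProduct_pow_eq_zero {m : ℕ} {v : Fin m → ℝ} (hv : v ≠ 0) :
    {t : ℝ | v ⬝ᵥ (fun j : Fin m => t ^ (j : ℕ)) = 0}.Finite := by
  classical
  set q : Polynomial ℝ := ∑ j : Fin m, Polynomial.C (v j) * Polynomial.X ^ (j : ℕ) with hq
  have hcoeff : ∀ j : Fin m, q.coeff (j : ℕ) = v j := by
    intro j
    rw [hq, Polynomial.finsetSum_coeff]
    simp only [Polynomial.coeff_C_mul_X_pow]
    rw [Finset.sum_eq_single j]
    · simp
    · intro b _ hb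
      rw [if_neg]
      exact fun h => hb (Fin.ext h.symm)
    · intro h; exact absurd (Finset.mem_univ j) h
  have hq0 : q ≠ 0 := by
    intro h0
    apply hv
    funext j
    have := hcoeff j
    rw [h0, Polynomial.coeff_zero] at this
    exact this.symm
  have heval : ∀ t, q.eval t = v ⬝ᵥ (fun j : Fin m => t ^ (j : ℕ)) := by
    intro t
    rw [hq, Polynomial.eval_finsetSum]
    simp [dotProduct, Polynomial.eval_mul, Polynomial.eval_C, Polynomial.eval_pow, Polynomial.eval_X]
  refine (q.roots.toFinset.finite_toSet).subset fun t ht => ?_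
  rw [Set.mem_setOf_eq, ← heval] at ht
  rw [Finset.mem_coe, Multiset.mem_toFinset, Polynomial.mem_roots hq0]
  exact ht

end MomentCurve

section PairBalance

open Classical in
/-- **Balance from two opposite pairs.**  In the family indexed by `Bool × Bool`, if the members
`(true, s)` and `(false, s)` have eventually OPPOSITE signs at `0⁺` for both `s` (encoded as eventual
positivity of `a_s·f(true,s)` and of `c_s·a_s·f(false,s)` with `c_s < 0`), then at least half of the four
members are eventually negative and at least half eventually positive. [folklore] -/
theorem balance_of_opposite_pairs (f : Bool × Bool → ℝ → ℝ) (a c : Bool → ℝ)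
    (hc : ∀ s, c s < 0) (ha : ∀ s, a s ≠ 0)
    (hT : ∀ s, ∀ᶠ ε in 𝓝[>] (0 : ℝ), 0 < a s * f (true, s) ε)
    (hF : ∀ s, ∀ᶠ ε in 𝓝[>] (0 : ℝ), 0 < (c s * a s) * f (false, s) ε) :
    Fintype.card (Bool × Bool) ≤
        2 * (univ.filter (fun w => ∀ᶠ ε in 𝓝[>] (0 : ℝ), f w ε < 0)).card ∧
      Fintype.card (Bool × Bool) ≤
        2 * (univ.filter (fun w => ∀ᶠ ε in 𝓝[>] (0 : ℝ), 0 < f w ε)).card := by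
  set Neg := univ.filter (fun w : Bool × Bool => ∀ᶠ ε in 𝓝[>] (0 : ℝ), f w ε < 0) with hNeg
  set Pos := univ.filter (fun w : Bool × Bool => ∀ᶠ ε in 𝓝[>] (0 : ℝ), 0 < f w ε) with hPos
  have hcard : Fintype.card (Bool × Bool) = 4 := by simp
  rw [hcard]
  have hpair : ∀ s, ((true, s) ∈ Pos ∧ (false, s) ∈ Neg) ∨ ((true, s) ∈ Neg ∧ (false, s) ∈ Pos) := by
    intro s
    rcases lt_or_gt_of_ne (ha s) with hneg | hpos
    · right
      refine ⟨?_, ?_⟩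
      · rw [hNeg, Finset.mem_filter]
        exact ⟨mem_univ _, (hT s).mono fun ε h => neg_of_mul_pos_right h hneg.le⟩
      · rw [hPos, Finset.mem_filter]
        exact ⟨mem_univ _, (hF s).mono fun ε h =>
          pos_of_mul_pos_right h (mul_pos_of_neg_of_neg (hc s) hneg).le⟩
    · left
      refine ⟨?_, ?_⟩
      · rw [hPos, Finset.mem_filter]
        exact ⟨mem_univ _, (hT s).mono fun ε h => pos_of_mul_pos_right h hpos.le⟩
      · rw [hNeg, Finset.mem_filter]
        exact ⟨mem_univ _, (hF s).mono fun ε h =>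
          neg_of_mul_pos_right h (mul_neg_of_neg_of_pos (hc s) hpos).le⟩
  have ht := hpair true
  have hf0 := hpair false
  constructor
  · have : 2 ≤ Neg.card := by
      rcases ht with ⟨-, h1⟩ | ⟨h1, -⟩ <;> rcases hf0 with ⟨-, h2⟩ | ⟨h2, -⟩
      · exact two_le_card_of_mem_of_mem (by simp) h1 h2
      · exact two_le_card_of_mem_of_mem (by simp) h1 h2
      · exact two_le_card_of_mem_of_mem (by simp) h1 h2
      · exact two_le_card_of_mem_of_mem (by simp) h1 h2
    omega
  · have : 2 ≤ Pos.card := by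
      rcases ht with ⟨h1, -⟩ | ⟨-, h1⟩ <;> rcases hf0 with ⟨h2, -⟩ | ⟨-, h2⟩
      · exact two_le_card_of_mem_of_mem (by simp) h1 h2
      · exact two_le_card_of_mem_of_mem (by simp) h1 h2
      · exact two_le_card_of_mem_of_mem (by simp) h1 h2
      · exact two_le_card_of_mem_of_mem (by simp) h1 h2
    omega

end PairBalance

end Summit.ValiantsHypothesis.ValiantsHypothesis.Theorems.LacunarySymmetroidMatrixDescartes.Census.RealExp
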